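import Mathlib
import HarnessLib
import HarnessLib.Audit
import Summits.PneNP.Statement
import Literature.Computability.Complexity.Space
import Literature.Computability.Complexity.CNF
import Literature.Computability.Complexity.Classes
import Literature.Computability.Complexity.Promise
import Literature.Computability.Complexity.GraphEncodings

/-!
Route: RootDecompSpaceChain

DORMANT since 2026-09-04T11:30:04Z (reconciler: no traction for 5 d (last activity statement-checked at 2026-08-30T10:32:55Z); parked, not closed — `ledger route dormant route-PneNP-RootDecompSpaceChain --off` to reactivate) — unstaffed, not closed; items shared with open routes are served there. `ledger route dormant <id> --off` reactivates.

# Route RootDecompSpaceChain — Root decomposition N2: the uniform space chain — SAT outside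
DTISP(n², log n), dial lift, logspace residual

ROOT DECOMPOSITION CELL decomp-pnenp (D-0178; doctrine D-0170/0171/0172), gen 0, NODE N2 = the
UNIFORM SPACE CHAIN subtree shared by
lens-1 «MagnificationThreshold v1» (TRUNK, file
run/shared/lean/pub/decomp-pnenp/decomp-pnenp-lens-1/MagnificationThreshold.lean sha256
710125758c938c57…, critic CLEARED 2026-08-30T00:59:32Z), lens-4 «LogspaceLift v1»
(decomp-pnenp-lens-4/LogspaceLift.lean sha256 d971bbb5…,
CLEARED 00:51:29Z as the honest baseline node of the axis) and lens-3 «WitnessCostSpaceLadder v1»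
(decomp-pnenp-lens-3/WitnessCostSpaceLadder.lean
sha256 58167303…, CLEARED 00:56:06Z as a duplicate of lens-4 plus a Levin-Kt READING of the
residual), typed by the route-writer decomp-pnenp-writer-1
with lens-1's statements verbatim (critic: «take lens-1's file as the TRUNK of the space-chain
subtree»).
REV 1 (gen 2, 2026-08-30): CHILD NODE «GapCliqueDial» (lens-1 g2;
HOME/decomp-pnenp-lens-1/GapCliqueDial.lean sha256
749dcffff8dd437b96712e008d1f5fb67f1fde7b9d504338303e55d9e6990ce9, NODE-g2.md sha256
33764b1f708e0dc2295f8cd75a3e1ea617d166e42645f6a0771df63ae89bda1f;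
it imports this born trunk), critic CLEARED 2026-08-30T01:56:42Z with flags F1 INTERLEAVING / F2
ZERO-SUM / F3 BINDERS (erratum 01:56:55Z;
probe critic/L1_GapCliqueDial_g2_probe.lean sha256
96cf172cee3a66cf61c938cb4d9ba2256911f76480af19d13f5820f47b043285; CRITIC-LEDGER row «lens-1
GapCliqueDial g2»), filed per the critic's FILING ADVICE («not a new root route — CHILD of N2 at
stmt-PneNP-23729 (refines_shadowResidual);
until the --refines schema is live, asides on N2») as THREE ASIDE record items typed over tree
declarations only (the lens-local notions
gapYes/gapNo/GapClique/GapFine are inlined; writer file bc/N2_GapClique_items.lean sha256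
e534e8f66c50a526ebd9732eeca6575b37f16b7a9574066d6da3279400adfa3a,
lean rc 0 / 0 err / 0 warn / 0 sorry, with Iff.rfl certificates gapQuarterFineItem_iff /
jointResidualItem_iff / gapDialItem_iff against a
verbatim copy of the lens definitions): GapQuarterFine (G, the NECESSARY open rung of a NEW axis),
JointResidual (J, residual variant) and GapDial
(EQUIV record, binders named). REFINES R₂ = ShadowResidual (stmt-PneNP-23729): G ∧ J ⟹ R₂ (kernel
refines_shadowResidual; writer
shadowResidual_of_gap_joint) and R₂ ⟹ J (jointResidual_of_shadowResidual); tag «refines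
route-PneNP-RootDecompSpaceChain:stmt-PneNP-23729».
Pieces, statements, glue and cone of N2 UNCHANGED (closes hA hLift hRes := hRes (hLift hA); the
asides are not binders of closes by design). It suffices to show X = A ∧ R₁ ∧ R₂, and
X is EQUIVALENT to S = P ≠ NP (kernel pneNP_iff_node in the trunk file, modulo the tree theorem
LOGSPACE ⊆ P = LOGSPACE_subset_P_holds,
TimeSpaceChainProofs.lean:513): A = SatQuadLogspace — SAT ∉ DTISP(n², log n) (level 2 of the dense
time–space dial ShadowTS c := SAT ∉ DTISP(n^c, log n),
census row B2; ≡ lens-4 RungTwo, same term); R₁ = DialLift — SAT ∉ DTISP(n², log n) → SAT ∉ LOGSPACE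
(the climb from level 2 to the top of the dial);
R₂ = ShadowResidual — SAT ∉ LOGSPACE → P ≠ NP (≡ lens-3 SpaceToTimeLift literally, ⟺ lens-4
LiftFromL by liftFromL_iff_residual). Two-level reading:
S ⟺ SATNotInL ∧ R₂ and SATNotInL ⟺ A ∧ R₁ (kernel satNotInL_iff_quad_and_lift), SATNotInL := SAT ∉
LOGSPACE = lens-4 piece A = census row B1 shadow
(filed as record item SATNotInL, kind aside). NODE KIND: AND, exact, EQUIV-free (one root
equivalence; nested law-D normal form flagged by the critic F1:
the summit is carried WHOLLY by R₂ ⟺ (SAT ∉ L → S); residual of record = (SAT ∉ L → S) = the census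
§2 baseline partner, now typed, NOT weaker than baseline).
PIECE TAGS (critic verdict lines HOME/CRITIC-LEDGER.md / STATUS.md 00:51:29Z, 00:56:06Z, 00:59:32Z
cited per piece): A SatQuadLogspace — WEAKER(formal,
kernel satQuadLogspace_of_pneNP mod hLP) · NECESSARY(a,b) · not COSTUME · not LAW-A · OPEN and
CALIBRATED (first integer level above both certified method
ceilings in Space.lean's sequential one-head model) · leaf IDEA-NEEDED with an INSTRUMENTABLE
calibration = the cell's one kit-able UNDECIDED test (LP /
proof search over alternation-trading rules plus a crossing-sequence rule in the sequential model at
space log n); R₁ DialLift — WEAKER(formal;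
dialLift_of_pneNP, also implied by the shadow itself) · RESIDUAL-TYPE (rung-2 → top climb) ·
NECESSARY · IDEA-NEEDED; R₂ ShadowResidual —
DECLARED-RESIDUAL(SAT ∉ LOGSPACE) (kernel shadowResidual_weakest / lens-4 liftFromL_iff_residual) ·
WEAKER(formal) · NECESSARY · IDEA-NEEDED · carries
the summit; typed rungs beneath R₂ (record, not items): McspHigh / UniformStreamLB + the landed
magnification arrows = SUFFICIENT and OVERSHOOTING
(⟹ S), TransferAt c (c ≥ 3) = UNDECIDED/INCOMPARABLE and BARRIER-priced (A31/A34/A35). CHILD SPLIT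
OF R₂ (rev 1, record asides; critic verdict line STATUS.md
01:56:42Z cited per piece): R₂ ⟸ G ∧ J with G = GapQuarterFine — «GapClique(1/4) ∉
promise-DTIME_multi-stack(O(N))»: no linear-time multi-stack
language separates graphs with ω ≥ n^{3/4} from graphs with ω ≤ n^{1/4} (adjacency-matrix input, N ≈
n², n ≥ 2) · WEAKER(formal mod ONE print
binder: kernel gapQuarterFine_of_pneNP under CliqueGapNPHard = [Zuckerman 2007 Thm 1.1, gap form];
the promise-closure fact is DISCHARGED by the tree
theorem PromiseProblem.NP_subset_P_of_isNPHard_of_mem_PromiseP_holds (critic w1; writer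
gapQuarterFineItem_of_pneNP takes hZ only) and DTIME(n) ⊆ P is
the tree theorem DTIME_id_subset_P — no model debt) · NECESSARY · not COSTUME (no census row;
sandwiched SAT ∉ DTIME(n^{c_Z(1/4)}) ⟹ G ⟹ CLIQUE ∉
DTIME(N), both open; an explicit superlinear multitape lower bound, open since PPST83) · not LAW-A ·
shape i.o. like S · leaf IDEA-NEEDED ·
BARRIER-PRICED (relativization/algebrization price it exactly as they price S — false relative to a
CLIQUE oracle; LOCALITY: uniform CHOPRS analogue
with oracle fan-in N^{1/2+γ} at ε = 1/4, the full barrier as ε → 0; alternation trading reaches NO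
constant ε; crossing sequences localise; the RAM
probe-complexity question D_ε ∈ [n^{1+ε}/4, n^{1+2ε+γ}] is an ATTACKABLE CALIBRATION only, deciding
nothing about S); J = JointResidual — SAT ∉
LOGSPACE → G → S · DECLARED-RESIDUAL variant · WEAKER(formal) · NECESSARY · formally strictly weaker
than R₂ yet ⟺ R₂ GIVEN G (critic F2 ZERO-SUM,
writer jointResidualItem_iff_shadowResidual_of_gap: the residual is UNRELIEVED — no road into J uses
hG — so NO SCORE vs N2; node ⟺ N2 ∧ G: a new
NECESSARY conjunct and a new typed axis, stated by the lens itself) · leaf IDEA-NEEDED · carries the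
summit · false exactly in the world SAT ∉ L ∧
G ∧ P = NP. ONE EQUIV LAYER above the split (record aside GapDial): S ⟺ ∀ ε > 0, GapClique ε ∉
promise-DTIME(O(N)) (kernel pneNP_iff_gapDial /
writer pneNP_iff_gapDialItem, modulo the binders CliqueGapNPHard [Zuc07] and BlockMagnification
[Srinivasan 2003 Thm 3.1(iii) block
self-reduction + kernel clique_block_pigeonhole + elementary multi-stack accounting s = 2^⌈ℓ/4k⌉, T
= 2^{⌈ℓ/10k⌉+1}, ⌈n/s⌉ blocks × O(s^{2k}) =
o(N); critic re-did the arithmetic; model trap checked: FinTM2 multi-stack linear time, not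
one-tape]; monotone in ε, gapFine_mono) = the FIRST
S-IMPLIED (necessary) magnification antecedent family in the cell; critic F1 INTERLEAVING: the
ε-dial is COFINALLY INTERLEAVED with the
definitional time-exponent dial (down: GapFine ε ⟸ SAT ∉ DTIME(n^{c_Z(ε)}) by Zuckerman's blow-up;
up: GapFine ε ⟹ NP ⊄ DTIME(n^{k(ε)}), k(ε) ≈
1/(10ε), by the block binder read contrapositively), so «S ⟺ ∀ε GapFine ε» is «S ⟺ ∀k NP ⊄
DTIME(n^k)» seen through two NEW typed comparison maps —
not a new limit object; a single constant-ε rung magnifies only to the fixed-exponent rung k(ε),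
never to S, and at ε = 1/4 (k < 1) the magnified
consequence is empty, which is WHY G is maximally weak. LENS-1 THRESHOLD THEOREM #2 (pencil,
accepted with the F1 sharpening): dense gap antecedents
are necessary only at CONSTANT ε [Zuc07], single-antecedent magnification to S only as ε → 0 [Sri03
LB2], where only quasi-NP-hardness is known
[Khot–Ponnuswami 2006 Thm 1]; with T1 (gen 0: sparse antecedents are never necessary, HIS85) ⇒
magnification yields law-D root nodes only. Leaves ATTACKABLE 0 (rung 1 of A's ladder is a
kernel CALIBRATION task, not an attack on S) / INSTRUMENTABLE 1 (A's LP calibration) / IDEA-NEEDED 3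
/ BARRIER 0. After rev 1 (child
included): ATTACKABLE-toward-S 0 / INSTRUMENTABLE 1 / CALIBRATION +1 (RAM probe complexity D_ε,
pencil, kit-free) / IDEA-NEEDED 5 (A, R₁, R₂,
G, J) / BARRIER 0 (priced, not excluded). INSTRUMENT DATA: census/COSTUME-CENSUS-v1.json sha256
c3edddb4706a328d44a5e0d24af1b9951612412f3319dff241290bec3760c9a9 (.md sha256
ca5b9db7c1a77f53851c4527da7ebb1687b4f3c67d5a358def525dbcd5c03f30), rows
B1/B2 (B2 correction upheld by the critic: in the sequential-input model the theorem region at space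
log n is c < 2 by crossing-sequence
information, Cobham 1966 + Santhanam 2001). WHY THIS IS NOVEL: no PneNP Theses file decomposes the
root through the uniform time–space shadow; the
magnification routes (UniformStream, Circuit2, MetaCplx) put a ≥ S sparse lower bound in `closes`,
whereas here every binder of `closes` is a
consequence of S and the magnification kernel appears only as an overshooting rung under a typed
residual — the magnification template inverted
(dense-necessary instead of sparse-sufficient), with the census's «partner-less shadow» given a
typed, certified-≡-residual partner and a typed
exponent ladder whose first rung is a theorem in the tree's own machine model. Rev 1 adds (critic's
wording): the first S-implied
magnification antecedent family, cofinal with the time-exponent dial, with new typed comparison maps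
(Zuckerman down, block self-reduction up)
— the magnification template made NECESSARY at constant gap exponent, where print has only
sufficient (ε → 0, sparse) antecedents. Rung currency: LADDER rung 0 (nothing here proves P ≠ NP).
Lean: `(Literature.Computability.Complexity.SAT ∉ Literature.Computability.Complexity.DTISP (fun n
=> n ^ 2) (Nat.log 2)) ∧ (Literature.Computability.Complexity.SAT ∉
Literature.Computability.Complexity.DTISP (fun n => n ^ 2) (Nat.log 2) →
Literature.Computability.Complexity.SAT ∉ Literature.Computability.Complexity.LOGSPACE) ∧
(Literature.Computability.Complexity.SAT ∉ Literature.Computability.Complexity.LOGSPACE → PneNP)`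

## Assembly
Modus ponens twice: R₁ turns A into SAT ∉ LOGSPACE, R₂ turns that into P ≠ NP; every binder is
consumed. The deciding theorem `closes` in
glue.lean is `hRes (hLift hA)` (hypothesis-free). Conversely S ⟹ each piece (kernel in the trunk
file mod hLP), so the node is an equivalence.
Rev 1 child (record): R₂ ⟸ GapQuarterFine ∧ JointResidual (refines_shadowResidual: fun hL => hJ hL
hG), so the four-binder node
closes′ hA hLift hG hJ := hJ (hLift hA) hG decides the root as well (lens closes; writer
pneNP_of_node); not installed as this route's glue
(critic: asides until the --refines schema is live).

Rationale: WHY THIS LINE. The uniform space chain DTISP(n^k, log n) ⊆ LOGSPACE ⊆ P ⊆ NP is the one axis on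
which natural proofs (A8–A10) and algebrization (A6) do not
quantify over the statements at all (uniform explicit-machine lower bounds) and on which every
finite rung is attacked by machine-structural
(non-black-box) crossing-sequence arguments; relativization prices only the limit statement SAT ∉ L
(L^QBF = NP^QBF, Ladner–Lynch model
conventions) and the alternation-trading component, which is relativizing and METHOD-CAPPED
(Buss–Williams 2015, doi:10.1007/s00037-015-0104-9;
census A1/B2). The dense dial levels are implied by S and imply nothing back; the sparse
magnification levels (McKay–Murray–Williams 2019 Thm
1.1/1.3, MckayMurrayWilliams2019; arrows landed in the tree: uniformStreamLB_of_id_high,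
uniformStream_uniformMagnification_proof,
pneNP_of_MCSP_id_not_mem_DTISP_high) imply S and sit as rungs under the residual — the lens's
THRESHOLD THEOREM (no level of either dial is both
necessary and sufficient), accepted by the critic. Rung 1 of A's ladder (SAT ∉ DTISP(n, log n)) is a
THEOREM IN PRINT in the tree's sequential
one-head model (Cobham 1966 / Santhanam 2001 T·S = Ω(n²/polylog), quoted
[corpus:paper:doi-10-1109-ccc-2005-6 p.5]; acq-14831 filed by the critic
for IPL 79:243), kernel precedent
Literature.Computability.MetaComplexity.ChenJinSanthanamWilliams2022.OneTapePALLowerBound.palLowerBound_holds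
(Hennie cut-and-paste) — a BC5 calibration witness in a regime where S's own rung 1 (SAT ∉ DTIME(n),
multi-stack) is open; rung 2 = A sits where two
certified method ceilings meet (two-party information T·S = Θ(n²), tight for PAL; RAM alternation
trading n^(2cos(π/7)), Williams arXiv:1001.0746
p.4 / Conj 3.1). Imported: time–space tradeoffs (AroraBarak2009 Def 5.10), crossing sequences
(KushilevitzNisan1997 §12.2), hardness magnification as
rungs only. Lens-3's Kt annotation on R₂ (spaceToTimeLift_iff_kt: R₂ ⟺ (SAT ∉ L → KtWitnessCost U),
Levin equivalence = tree theorem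
soloInformed_pneNP_iff_exists_costly_witnesses) is a READING of the residual, not a piece (critic
00:56:06Z). REV 1 (gen 2) adds the DENSE GAP AXIS under R₂ (lens-1 g2 GapCliqueDial, critic
CLEARED 2026-08-30T01:56:42Z): Zuckerman's derandomised n^{1-ε} clique inapproximability
(doi:10.1145/1132516.1132612 Thm 1.1, gap form,
[corpus:paper:doi-10-1145-1132516-1132612 p.2/p.14]) makes every promise problem GapClique ε (YES ω
≥ n^{1-ε}, NO ω ≤ n^{ε}) NP-hard, so S
implies LINEAR-TIME multi-stack hardness of every rung (kernel; promise closure discharged by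
NP_subset_P_of_isNPHard_of_mem_PromiseP_holds,
DTIME_id_subset_P), while Srinivasan's block self-reduction (doi:10.1016/S0022-0000(03)00110-7 Thm
3.1(iii), [corpus:paper:doi-10-1016-s0022-0000-03-00110-7
p.7]) with the kernel pigeonhole clique_block_pigeonhole gives the converse for the WHOLE dial
(binder BlockMagnification): S ⟺ ∀ ε > 0 GapFine ε.
Imported: PCP inapproximability (necessity side) and uniform dense-gap hardness magnification
(sufficiency side; CHOPRS arXiv:1911.08297 App. A
[corpus:paper:arxiv-1911.08297 p.36] is the non-uniform rendering); the filed rung G = GapFine(1/4)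
is the law-D split point beneath the EQUIV layer.

RANKED CRUXES. #2 SatQuadLogspace (crux) — PIECE A · tag WEAKER(formal; kernel
satQuadLogspace_of_pneNP in the trunk file sha256 71012575…, mod hLP = tree theorem
LOGSPACE_subset_P_holds; converse unknown) · NECESSARY · not COSTUME · not LAW-A · ≡ lens-4 RungTwo
(same term) · leaf IDEA-NEEDED with INSTRUMENTABLE calibration (critic CLEARED 2026-08-30T00:59:32Z:
the LP/proof-search test over alternation-trading + crossing-sequence rules in the sequential model
is accepted as a real UNDECIDED test; census to price) · BC5 plan-only rung beneath it: ShadowTSOne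
= SAT ∉ DTISP(n, log n), theorem in print in this model — SAT is not decidable by an
input-preserving space machine simultaneously in time O(n²) and work space O(log n): level 2 of the
dense time–space dial, the first integer level above both certified method ceilings. [difficulty:
open-problem] (why it might fail: both known method families are provably capped at exponent 2 in
this model (alternation trading: Buss–Williams optimality; crossing-sequence information: tight at
T·S ≈ n² for palindromes), so a proof needs a rule outside both; as a statement it is S-implied, so
it fails only if P = NP.) [arXiv:1001.0746, doi:10.1007/s00037-015-0104-9, doi:10.1109/ccc.2005.6,
AroraBarak2009]
#3 DialLift (crux) — PIECE R₁ · tag WEAKER(formal; dialLift_of_pneNP, and implied by the shadow SAT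
∉ L itself, dialLift_of_satNotInL) · RESIDUAL-TYPE (the climb from dial level 2 to the top: «a
log-space SAT decider speeds up to quadratic time in log space») · NECESSARY · not COSTUME · not
LAW-A (under P = NP unknown) · leaf IDEA-NEEDED (no speed-up of space-bounded deciders below their
configuration count is known) · critic CLEARED 2026-08-30T00:59:32Z — if SAT ∉ DTISP(n², log n) then
SAT ∉ LOGSPACE. [difficulty: open-problem] (why it might fail: false exactly in a world where SAT ∈
L but no log-space SAT machine runs in time O(n²); the configuration count bounds log-space deciders
only by n^O(1), nothing known speeds them up to a FIXED exponent, and L = NP is unrefuted.)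
[AroraBarak2009, doi:10.1109/ccc.2005.6, FortnowLiptonVanMelkebeekViglas2005]
#4 ShadowResidual (crux) — PIECE R₂ · tag DECLARED-RESIDUAL(SAT ∉ LOGSPACE) (kernel
shadowResidual_weakest; ⟺ lens-4 LiftFromL by liftFromL_iff_residual; ≡ lens-3 SpaceToTimeLift
literally) · WEAKER(formal; S ⟹ R₂ trivially; R₂ holds in the unrefuted world L = NP) · NECESSARY ·
carries the summit · leaf IDEA-NEEDED (no downward collapse propagation P = NP ⟹ NP ⊆ M for any M ⊊
P is known; typed rungs beneath it are either SUFFICIENT and overshooting — McspHigh /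
UniformStreamLB with the landed magnification arrows — or UNDECIDED/INCOMPARABLE and barrier-priced
— TransferAt c, c ≥ 3, A31/A34/A35) · UNDECIDED test for the census (lookup): a Ladner–Lynch-model
oracle O with L^O ⊊ P^O = NP^O, model named · critic CLEARED 2026-08-30T00:51:29Z / 00:59:32Z ·
tribunal filing residual: ShadowResidual — NP ≠ L (in SAT form) implies P ≠ NP. [difficulty:
open-problem] (why it might fail: false exactly in the world SAT ∉ L ∧ P = NP, which no known result
excludes; every typed road into it (dense→sparse transfer + magnification) overshoots to ≥ S
conclusions or is ETH-refutable as a black-box reduction.) [MckayMurrayWilliams2019,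
arXiv:1001.0746, LadnerLynch1976, AroraBarak2009]
#9 SATNotInL (support) — RECORD NODE (kind aside at filing; never staffed): the top of the dense
dial, SAT ∉ LOGSPACE (NP ≠ L in SAT form; census row B1 shadow; lens-4 piece A SatNotInL and lens-3
SatNotLogspace verbatim); intermediate node SATNotInL ⟺ SatQuadLogspace ∧ DialLift (kernel
satNotInL_iff_quad_and_lift), S ⟹ it (hyp-free tree theorem SoloBlind.SAT_not_mem_LOGSPACE_of_pneNP,
Theorems/SoloBlindFloor.lean:42); its exponent ladder SatNotInDTISPLog k := SAT ∉ DTISP(n^k, log n)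
is anti-monotone in k and exhausts it (lens-4 LadderExhaustsL, provable now from time_lt_card).
[AroraBarak2009, doi:10.1109/ccc.2005.6]
#9 ShadowTSOne (support) — RECORD RUNG (kind aside at filing; BC5 plan-only witness for
SatQuadLogspace, CALIBRATION only per the critic — it decides nothing about S): level 1 of the dense
dial, SAT ∉ DTISP(n, log n) — a THEOREM IN PRINT in the tree's sequential one-two-way-input-head
model (Cobham 1966 crossing sequences + Santhanam 2001, T·S = Ω(n²/polylog) for SAT; region c + d <
2), kernel road = adapt the formalised Hennie cut-and-paste
(OneTapePALLowerBound.palLowerBound_holds) to SpaceMachine with crossing records (state, work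
stacks), an in-model PAL→SAT embedding, DTISP closure; implied by SatQuadLogspace (DTISP
monotonicity, writer file bc/N2_SatQuadLogspace_rung.lean) while S's own rung 1 (SAT ∉ DTIME(n),
multi-stack) is open. [doi:10.1109/ccc.2005.6, Cobham1966, KushilevitzNisan1997]
#9 GapQuarterFine (support) — RECORD RUNG G of the CHILD NODE GapCliqueDial (kind aside at filing;
never staffed; rev 1, lens-1 g2 sha256 749dcfff…, critic CLEARED 2026-08-30T01:56:42Z; refines
route-PneNP-RootDecompSpaceChain:stmt-PneNP-23729): no LINEAR-TIME multi-stack language separates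
graphs with ω(G) ≥ n^{3/4} from graphs with ω(G) ≤ n^{1/4} (adjacency-matrix input N ≈ n², n ≥ 2;
GapClique(1/4) ∉ promiseLift (DTIME id), lens-local notions inlined, writer Iff.rfl
gapQuarterFineItem_iff) · tag WEAKER(formal mod the print binder CliqueGapNPHard [Zuc07 Thm 1.1];
kernel gapQuarterFine_of_pneNP, promise closure discharged, DTIME_id_subset_P) · NECESSARY · not
COSTUME (sandwiched between SAT ∉ DTIME(n^{c_Z(1/4)}) and CLIQUE ∉ DTIME(N), both open) · not LAW-A
· leaf IDEA-NEEDED · BARRIER-PRICED (rel/alg as S via a CLIQUE oracle; Locality: oracle fan-in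
N^{1/2+γ}; alternation trading reaches no constant ε; crossing sequences localise; RAM probe
complexity D_ε = ATTACKABLE CALIBRATION only) · bc5: none toward S (calibration only; gapFine_mono
and the trivial zone ε ≥ 1/2 do not count). (why it might fail: it does not fail under S;
unconditionally open — an explicit superlinear multitape lower bound for a dense NP-hard gap
problem, between CLIQUE ∉ DTIME(N) and SAT ∉ DTIME(n^{c_Z(1/4)}).) [doi:10.1145/1132516.1132612,
doi:10.1016/S0022-0000(03)00110-7, arXiv:1911.08297]
#9 JointResidual (support) — RECORD RESIDUAL VARIANT J of the child node (kind aside at filing;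
never staffed): SAT ∉ LOGSPACE → GapQuarterFine → P ≠ NP (G inlined; writer Iff.rfl
jointResidualItem_iff) · DECLARED-RESIDUAL of the child · WEAKER(formal; S ⟹ J trivially) ·
NECESSARY · formally strictly weaker than ShadowResidual (jointResidual_of_shadowResidual) and G ∧ J
⟹ ShadowResidual (refines_shadowResidual / writer shadowResidual_of_gap_joint), but ⟺ ShadowResidual
GIVEN G (critic F2 zero-sum; writer jointResidualItem_iff_shadowResidual_of_gap) — residual
unrelieved, no score vs N2 · leaf IDEA-NEEDED · carries the summit in the child. (why it might fail:
false exactly in the world SAT ∉ L ∧ GapQuarterFine ∧ P = NP, which no known result excludes; every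
typed road into it inherits R₂'s prices.) [MckayMurrayWilliams2019, doi:10.1145/1132516.1132612,
LadnerLynch1976, AroraBarak2009]
#9 GapDial (support) — EQUIV RECORD of the child node (kind aside at filing; never staffed): the
whole dial ∀ ε > 0, GapClique ε ∉ promiseLift (DTIME id) (writer Iff.rfl gapDialItem_iff); S ⟺
GapDial modulo the binders CliqueGapNPHard := ∀ ε > 0, IsNPHard (GapClique ε) [Zuckerman 2007 Thm
1.1 gap form; THEOREM IN PRINT, typing read by the critic: trivially true for ε ≥ 1/2, no junk] and
BlockMagnification := ¬S → ∃ ε > 0, GapClique ε ∈ promiseLift (DTIME id) [Srinivasan 2003 Thm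
3.1(iii) block self-reduction + kernel clique_block_pigeonhole + this node's elementary multi-stack
accounting, critic-verified arithmetic: YES side needs n^{1/(20k)} ≥ 16, NO side n^ε < T for ε ≤
1/(10k)] (kernel pneNP_iff_gapDial; writer pneNP_iff_gapDialItem with hProm discharged); monotone in
ε (gapFine_mono); under P = NP a whole initial segment of exponents is linear
(exists_linear_segment_of_not_pneNP); critic F1: cofinally interleaved with the time-exponent dial
∀k NP ⊄ DTIME(n^k) (= unfolding of P) through two typed comparison maps; binders are record (print +
pencil), NOT items and NOT in closes. [doi:10.1145/1132516.1132612,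
doi:10.1016/S0022-0000(03)00110-7, arXiv:1911.08297, doi:10.1007/11786986_21]

TWO-LAYER PLAN. Under A: the exponent ladder ShadowTS c (c = 1 theorem in print = BC5 plan-only rung
ShadowTSOne, kernel calibration task; c = 2 = A itself, IDEA-NEEDED
with the LP calibration test; c ≥ 3 IDEA-NEEDED); lens-4's dial lemmas (hardFor_anti / liftFrom_mono
zero-sum, LadderExhaustsL, DTISP_mono_succ,
rung-1 in-model theorem) are the support layer, not filed as items. Under R₂: sufficient
overshooting rungs McspHigh → S (kernel via the landed
arrows), UniformStreamLB → S; INCOMPARABLE rungs TransferAt c (c ≥ 3) with prices; lens-3's Kt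
reading. SCORING RULE for gen 1 (critic, zero-sum
liftFrom_mono): the residual of record weakens only by moving M UP the chain (NL, SC, NC, …) with a
typed attack surface under SAT ∉ M'. REV 1: under
R₂ the CHILD SPLIT R₂ ⟸ GapQuarterFine ∧ JointResidual (lens-1 g2; record asides GapQuarterFine /
JointResidual / GapDial; to be re-hung as
--refines route-PneNP-RootDecompSpaceChain:stmt-PneNP-23729 when the gate schema is live); the
pure-axis pair (GapQuarterFine, GapResidual :=
GapQuarterFine → S; pneNP_iff_gapNode) is the baseline law-D node of the new axis and is NOT born
separately (critic); the binders CliqueGapNPHard /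
BlockMagnification stay record. Nothing else filed now.

KILL CRITERIA. Each piece is S-implied, so a refutation of any piece refutes P ≠ NP itself; the
route is MOOTED (not refuted) if SAT ∉ LOGSPACE is proved outright
(then A and R₁ close and the route reduces to R₂ alone = «NP ≠ L ⟹ P ≠ NP», a bare residual) — at
that point it must be re-cut higher on the chain
or retired not-a-thesis. If the LP calibration test shows the combined alternation-trading +
crossing-sequence system still capped at exponent 2,
A's leaf becomes BARRIER(method-capped) and the node goes dormant pending a new ingredient. Child
(rev 1): G is S-implied modulo Zuckerman's
theorem, so a linear-time multi-stack separator for GapClique(1/4) would refute P ≠ NP itself; J is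
refuted only together with S; the child is
MOOTED if G is proved outright (then it reduces to N2 again: J ⟺ R₂ given G) — G proved would be an
explicit superlinear multitape lower bound
for an NP-hard dense gap problem, banked as a rung, scoring nothing against R₂.

NOT DECOMPOSED YET. The SpaceMachine crossing-sequence lemma (rung 1 in kernel), the LP test
specification (rules, model, target — critic w2 for lens-1), the oracle
model for R₂'s UNDECIDED test (critic w4 for lens-4), the Kt/KS-typed form of SAT ∉ L (critic w1 for
lens-3; SAT self-reduction is not known to
run in log space), and the sparse-dial rungs (McspStreamLevel c, TransferAt c, MagnificationArrows)
stay in the lens files as record. Rev 1: the binders CliqueGapNPHard (candidate Literature named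
fact: Zuckerman 2007 Thm 1.1 in
gap form over a Literature-level GapClique definition) and BlockMagnification (pencil; kernel half
clique_block_pigeonhole done, machine
accounting not typed), the RAM probe-complexity calibration D_ε (three zones: δ < ε Turán adversary,
ε ≤ δ < 2ε open, δ > 2ε magnification), the
repair census of the lens (tried: DTISP rendering, RAM rendering, space axis = COSTUME of B1,
constant gaps, other sub-samplable problems, sparse
antecedents, infinite AND, two non-residual pieces; untried: Hirahara non-disjoint GapMKtP,
Feige–Kilian self-improvement) stay in
GapCliqueDial.lean / NODE-g2.md as record.

CHEAPEST FALSIFIER. Lookup, run by the lens and the critic: is any binder refuted by a registered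
strong hypothesis or a catalogued oracle? No — all three are
S-implied; the only oracle facts (L^QBF = P^QBF = NP^QBF) make R₂ TRUE relative to QBF. In-Lean
(critic probes L1/L4): `example : DialLift ∧
ShadowResidual → PneNP` and `example : SatQuadLogspace → PneNP` fail (BGS-type worlds), confirming
every piece is load-bearing and none is S.
The one kit-able test (A's LP calibration, 5–20 core-h by the census's price for reproducing
Williams' LP plus modelling work) is not run by
this seat (kit_allowed = false). Rev 1 (critic probe L1_GapCliqueDial_g2_probe.lean sha256
96cf172c…, rc 0): `example : GapQuarterFine →
PneNP` is not closable (BC2: G mentions neither SAT nor NP; only road = NP-hardness binder +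
residual), joint_residual_given_G and
node_is_N2_and_G certify F2, interleaved_dials_same_closure certifies F1; cheapest falsifier of G as
typed = vacuity (checked: YES/NO disjoint for
ε < 1/2 since instances carry n ≥ 2; DTIME id in the FinTM2 multi-stack model is genuine multitape
linear time, not the one-tape regular class).

NUMBERS. Dense dial: SAT ∉ DTISP(n^c, n^d) known for c + d < 2 in the sequential-input model
(crossing sequences; T·S = Ω(n²/polylog)), and for
c < 2cos(π/7) ≈ 1.8019, d = o(1) on RAMs (alternation trading, optimal for the framework); level 2
open by a log factor for PAL-type arguments
(PAL ∈ DTISP(n²/log n, log n)). Sparse dial: streaming levels c ≤ 1 unconditional (one-pass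
counting), c ≥ 3 jointly ⟹ P ≠ NP (MMW19 Thm 1.3,
landed). Leaf counts: ATTACKABLE 0, INSTRUMENTABLE 1, IDEA-NEEDED 3, BARRIER 0; record items 2
(SATNotInL, ShadowTSOne); after rev 1 record items 5 (+ GapQuarterFine,
JointResidual, GapDial), leaves ATTACKABLE-toward-S 0 / INSTRUMENTABLE 1 / CALIBRATION 1 /
IDEA-NEEDED 5 / BARRIER 0. GAP DIAL (rev 1): GapClique ε
disjoint for ε < 1/2, trivial (GapFine ε true) for ε ≥ 1/2; block algorithm M_k correct for ε ≤
1/(10k) with n^{1/(20k)} ≥ 16, total time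
⌈n/s⌉ · O(s^{2k}) = O(n^{3/2}) = o(N); RAM probe zones at each ε: time n^{1+δ}, δ < ε provably
insufficient (Turán adversary: after < n^{1+ε}/4
probes an unprobed n^{1-ε}-set survives), ε ≤ δ < 2ε open, δ > 2ε magnification zone. BC8 (G,
labelled): Relativization/Algebrization — inside as
a statement, priced exactly as S (CLIQUE oracle: one query makes every GapClique ε linear)
[Literature/Barriers/PneNP/Relativization.lean,
Algebrization.lean]; NaturalProofs — n/a (uniform machine statement); Locality — uniform analogue
applies with oracle fan-in N^{2ε+γ} = N^{1/2+γ}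
at ε = 1/4 [Literature/Barriers/PneNP/Locality.lean `not_localizing_clique_lower_bound`;
corpus:paper:arxiv-1911.08297 p.36]: a method tolerating
oracle queries of size N^{0.51} cannot prove G; BoundedRelativization — J inherits it in full as R₂
does. BC9 (G): method_family =
alternation-trading (via SAT shadow; capped below 2cos(π/7) [corpus:paper:arxiv-1001.0746 p.4],
reaches no constant ε) + crossing sequences
(localise) + query/adversary (RAM calibration); ladder_ceiling = capped-at-D_ε (probe cost, below
the probe + solve threshold); ceiling_lift = a
uniform lower-bound method charging for PROCESSING probe answers (non-localising ∧ non-relativising)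
= none known [declared: the residual's
content]; ceiling_sources = [corpus:paper:arxiv-1911.08297 p.36;
Literature/Barriers/PneNP/Locality.lean; corpus:paper:arxiv-1001.0746 p.4].

DEFINITION REQUESTS. None: SAT, DTISP, LOGSPACE, Classes.P exist in
Literature.Computability.Complexity (CNF.lean:435, Space.lean:242/225). Rev 1: none either —
PromiseProblem.ofEncoding / promiseLift (Promise.lean:91/152), encodingGraph
(GraphEncodings.lean:135), DTIME (Classes.lean:73) and Mathlib's
SimpleGraph.cliqueNum type the gap items; route imports gain
Literature.Computability.Complexity.Promise and .GraphEncodings.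

Novelty: Searches (2026-08-30, run by lenses 1/3/4 and the critic, adopted; the writer re-ran the tree scan
and the negatives index): rg "DTISP|LOGSPACE" over lean/Summits/PneNP/PneNP/Theses (space statements
only in BorrowedMemory (catalytic) and the SoloBlind/UniformStream families as ≥ S or shadow
supports; no root decomposition through the dense dial); lit search --hybrid "time space lower
bounds SAT alternation trading" ([corpus:paper:arxiv-1001.0746 p.4], Buss–Williams 2015); lit search
"crossing sequences palindromes time space" ([corpus:paper:doi-10-1109-ccc-2005-6 p.5 fn 1]; IPL
79:243 not held → acq-14831); lit galaxy search "Williams alternation-trading" --star pdf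
([galaxy:pdf:2968178060 p.3, Conj 3.1 p.26, Thm 3.3 p.27]); ledger negatives --problem PneNP (6
entries, none on space classes; writer re-run 2026-08-30).
Nearest prior art found: route-PneNP-UniformStream / Circuit2 / MetaCplx (sparse magnification lower
bounds ≥ S in closes); route-PneNP-SoloBlind family (SAT ∉ P anchor, SAT_not_mem_LOGSPACE_of_pneNP
as a shadow support); Williams arXiv:1001.0746 and Buss–Williams 2015 (the dense-dial method and its
ceiling); McKay–Murray–Williams 2019 (the sparse dial).
Delta: the root is cut through the S-implied dense time–space dial with the residual typed and
certified ≡ (SAT ∉ L → S), magnification inverted into overshooting rungs under that residual, and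
the first open dense rung placed exactly where two certified method ceilings meet in the tree's own
machine model.
Cla  [refs: 1001.0746, paper:arxiv-1001.0746, paper:doi-10-1109-ccc-2005-6]

Barriers (technique_class: time-space tradeoffs, crossing sequences, uniform shadows): - technique_class: time-space tradeoffs, crossing sequences, uniform shadows
- Literature.Barriers.PneNP.Relativization: A and R₁ are uniform fixed-exponent machine statements;
the crossing-sequence arguments that reach the floor are machine-structural (non-black-box), while
the alternation-trading component IS relativizing and method-capped (Buss–Williams; census A1/B2) —
cited as such; BGS prices only the limit SAT ∉ L (L^QBF = NP^QBF, Ladner–Lynch conventions) and R₂,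
whose relativization status is model-dependent; the bet is that finite rungs fall to structural
arguments and R₂ needs a non-relativizing idea (IDEA-NEEDED, declared residual).
- Literature.Barriers.PneNP.BoundedRelativization: PSPACE-relativizing techniques cannot prove S; R₂
(the summit-carrying residual) inherits this in full — it does not evade it; the bet is confined to
the finite dense rungs, which are below the barrier's quantifier (fixed-polynomial DTISP statements
proved by simulation/information arguments).
- Literature.Barriers.PneNP.NaturalProofs: does not apply — no piece asserts a circuit lower bound
or a constructive/large property (A8–A10 do not quantify over uniform explicit-machine statements).
- Literature.Barriers.PneNP.Algebrization: does not apply to A / R₁ for the same reason; R₂ as a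
class-separation transfer is inside AW's scope as a statement (the bet is as for Relativization).
- Literature.Barriers.PneNP.Locality: prices only the sparse rungs under R₂ (hardness magnification
for MCS

History (route lifecycle, newest last):
- 2026-09-04T11:30:04Z · DORMANT — reconciler: no traction for 5 d (last activity statement-checked at 2026-08-30T10:32:55Z); parked, not closed — `ledger route dormant route-PneNP-RootDecompSpac (operator:999:773710)

sub-problem: PneNP · status: dormant · opened planner-decomp-pnenp-writer-1-g0-0 2026-08-30T01:19:56Z · rev 5 · ledger route-PneNP-RootDecompSpaceChain
GENERATED by the gate from the ledger (D-0016/17). Provers cite these decls: `theorem foo : Summit.PneNP.PneNP.Theses.RootDecompSpaceChain.<Decl> := …` in Summits/PneNP/PneNP/Theorems/<Name>.lean.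
-/

namespace Summit.PneNP.PneNP.Theses.RootDecompSpaceChain

open scoped BigOperators Topology Manifold Classical MeasureTheory ProbabilityTheory Matrix InnerProductSpace ComplexConjugate ContinuousMap
open Filter Set Function TopologicalSpace MeasureTheory

attribute [summit_statement] _root_.PneNP

open Literature.PNP

/-- item stmt-PneNP-23487 · crux · rank 2 · open · by planner
why it might fail: both known method families are provably capped at exponent 2 in this model (alternation trading: Buss–Williams optimality; crossing-sequence information: tight at T·S ≈ n² for palindromes), so a proof needs a rule outside both; as a statement it is S-implied, so it fails only if P = NP.
sources: arXiv:1001.0746, doi:10.1007/s00037-015-0104-9, doi:10.1109/ccc.2005.6, AroraBarak2009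
[crux] PIECE A · tag WEAKER(formal; kernel satQuadLogspace_of_pneNP in the trunk file sha256
71012575…, mod hLP = tree theorem LOGSPACE_subset_P_holds; converse unknown) · NECESSARY · not
COSTUME · not LAW-A · ≡ lens-4 RungTwo (same term) · leaf IDEA-NEEDED with INSTRUMENTABLE
calibration (critic CLEARED 2026-08-30T00:59:32Z: the LP/proof-search test over alternation-trading
+ crossing-sequence rules in the sequential model is accepted as a real UNDECIDED test; census to
price) · BC5 plan-only rung beneath it: ShadowTSOne = SAT ∉ DTISP(n, log n), theorem in print in
this model — SAT is not decidable by an input-preserving space machine simultaneously in time O(n²)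
and work space O(log n): level 2 of the dense time–space dial, the first integer level above both
certified method ceilings. [difficulty: open-problem] -/
@[route_item "route-PneNP-RootDecompSpaceChain"]
def SatQuadLogspace : Prop :=
  Literature.Computability.Complexity.SAT ∉ Literature.Computability.Complexity.DTISP (fun n => n ^ 2) (Nat.log 2)

/-- item stmt-PneNP-23488 · crux · rank 3 · open · by planner
why it might fail: false exactly in a world where SAT ∈ L but no log-space SAT machine runs in time O(n²); the configuration count bounds log-space deciders only by n^O(1), nothing known speeds them up to a FIXED exponent, and L = NP is unrefuted.
sources: AroraBarak2009, doi:10.1109/ccc.2005.6, FortnowLiptonVanMelkebeekViglas2005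
[crux] PIECE R₁ · tag WEAKER(formal; dialLift_of_pneNP, and implied by the shadow SAT ∉ L itself,
dialLift_of_satNotInL) · RESIDUAL-TYPE (the climb from dial level 2 to the top: «a log-space SAT
decider speeds up to quadratic time in log space») · NECESSARY · not COSTUME · not LAW-A (under P =
NP unknown) · leaf IDEA-NEEDED (no speed-up of space-bounded deciders below their configuration
count is known) · critic CLEARED 2026-08-30T00:59:32Z — if SAT ∉ DTISP(n², log n) then SAT ∉
LOGSPACE. [difficulty: open-problem] -/
@[route_item "route-PneNP-RootDecompSpaceChain"]
def DialLift : Prop :=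
  Literature.Computability.Complexity.SAT ∉ Literature.Computability.Complexity.DTISP (fun n => n ^ 2) (Nat.log 2) → Literature.Computability.Complexity.SAT ∉ Literature.Computability.Complexity.LOGSPACE

/-- item stmt-PneNP-23729 · crux · rank 4 · SPLIT (gen 1) into SatNotInPTSL, LiftFromPTSL + glue ShadowResidualGlue · direct attempts still welcome (low priority) · by planner
why it might fail: false exactly in the world SAT ∉ L ∧ P = NP, which no known result excludes; every typed road into it (dense→sparse transfer + magnification) overshoots to ≥ S conclusions or is ETH-refutable as a black-box reduction.
sources: MckayMurrayWilliams2019, arXiv:1001.0746, LadnerLynch1976, AroraBarak2009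
[crux] the declared residual of the split — if SAT is not in LOGSPACE then P ≠ NP (a space-to-time
lift of SAT hardness; in Levin-cost language: super-logarithmic space-bounded witness cost lifts to
super-logarithmic time-bounded witness cost). [difficulty: open-problem] -/
@[route_item "route-PneNP-RootDecompSpaceChain"]
def ShadowResidual : Prop :=
  Literature.Computability.Complexity.SAT ∉ Literature.Computability.Complexity.LOGSPACE → PneNP

-- parent: ShadowResidual · child (gen 1)
/--     item stmt-PneNP-26448 · crux · rank 401 · open
    parent: ShadowResidual · by planner
    why it might fail: S-implied (mod PTSL ⊆ P), so it fails only with P = NP; as a target: every decided cell sits strictly inside a/b + p/q < 2 (information bound, tight on the hyperbola for PAL-type arguments; alternation trading below it) — the open cells need a rule outside both families.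
    sources: doi:10.1109/ccc.2005.6, Cobham1966, AroraBarak2009, FortnowLiptonVanMelkebeekViglas2005, arXiv:1001.0746
[crux] CHILD A′ of the residual ShadowResidual (stmt-PneNP-23729) — the SUBLINEAR-SPACE SHADOW
(lens-4 gen 3 «SublinearSpaceLift», HOME/decomp-pnenp-lens-4/SublinearSpaceLift.lean sha256
593a919bde2e9d7151a8594e4ebab99824905827b4a2b6da84718c67af02b327, NODE-g3.md sha256 3e0fb24b…;
critic decomp-pnenp-crit-1 CLEARED 2026-08-30T02:57:17Z «law-D node at the END OF THE SPACE-EXPONENT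
CHART; birth admissible now; F5 sublinear branch under N2», probe
critic/L4_SublinearSpaceLift_g3_probe.lean sha256 d673552c; writer certificates
bc/N8_SublinearSpace_items.lean sha256 352a4910e2f1e922… + bc/N8b_Sublinear_asides.lean sha256
5ae8028615caa8b9… (Iff.rfl vs the lens defs, rc 0)): SAT ∉ PTSL := ⋃_{p<q} ⋃_k DTISP(n^k,
2^{⌊p⌊log₂n⌋/q⌋}) = DTISP(poly, n^{1−ε}) for every ε > 0, typed over the tree's one-head DTISP
(Space.lean) + CNF.SAT, lens helpers powFrac/PolyTimeSpace/PTSL inlined (no definition debt) · tags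
WEAKER(formal mod the aside PTSLSubsetP; lens satNotInPTSL_of_pneNP) · NECESSARY · not COSTUME (A′ ⟹
S fails only in a world P = NP ∧ SAT ∉ PTSL, unknown) · not LAW-A · STRONGER shadow than N2's log
column: A′ ⟹ LogspaceRungs 23728 ⟹ SatQuadLogspace 23487 (lens logspaceRungs_of_satNotInPTSL -/
@[route_item "route-PneNP-RootDecompSpaceChain"]
def SatNotInPTSL : Prop :=
  Literature.Computability.Complexity.SAT ∉ ⋃ p : ℕ, ⋃ q : ℕ, ⋃ (_ : p < q), ⋃ k : ℕ, Literature.Computability.Complexity.DTISP (fun n => n ^ k) (fun n => 2 ^ (p * Nat.log 2 n / q))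

-- parent: ShadowResidual · child (gen 1)
/--     item stmt-PneNP-26449 · crux · rank 402 · open
    parent: ShadowResidual · by planner
    why it might fail: False exactly in the world P = NP ∧ SAT ∉ DTISP(poly, n^{1−ε}) ∀ε, which nothing known excludes (no non-complete collapsing oracle either way: census V1 open); weaker than 23729 only modulo the clock 23730; every typed road (CapturePTSL) is believed false.
    sources: LadnerLynch1976, AroraBarak2009, doi:10.1109/ccc.2005.6, arXiv:2502.17779
[crux] CHILD B′ of the residual ShadowResidual (stmt-PneNP-23729) = RESIDUAL-OF-RECORD CANDIDATE for
the SPACE-EXPONENT CHART at its END (lens-4 gen 3 «SublinearSpaceLift»,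
HOME/decomp-pnenp-lens-4/SublinearSpaceLift.lean sha256
593a919bde2e9d7151a8594e4ebab99824905827b4a2b6da84718c67af02b327, NODE-g3.md sha256 3e0fb24b…;
critic decomp-pnenp-crit-1 CLEARED 2026-08-30T02:57:17Z «law-D node at the END OF THE SPACE-EXPONENT
CHART; birth admissible now; F5 sublinear branch under N2», probe
critic/L4_SublinearSpaceLift_g3_probe.lean sha256 d673552c; writer certificates
bc/N8_SublinearSpace_items.lean sha256 352a4910e2f1e922… + bc/N8b_Sublinear_asides.lean sha256
5ae8028615caa8b9… (Iff.rfl vs the lens defs, rc 0)): if SAT ∉ DTISP(poly, n^{1−ε}) for every ε then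
SAT ∉ P, i.e. (lens liftFromPTSL_iff_collapse) P = NP → SAT ∈ DTISP(poly, n^{1−ε}) for some ε · tags
DECLARED-RESIDUAL · WEAKER(formal; writer liftFromPTSLItem_of_pneNP, lens liftFromPTSL_of_pneNP) ·
not COSTUME · not LAW-A · leaf IDEA-NEEDED · KERNEL POSITION: BELOW 23729 (lens
liftFromPTSL_of_liftFromL mod the clock aside 23730 LogspacePolyClock +
polyTimeSpace_log_subset_half PROVED), below any SC / √n residual (liftFromPTSL_of -/
@[route_item "route-PneNP-RootDecompSpaceChain"]
def LiftFromPTSL : Prop :=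
  (Literature.Computability.Complexity.SAT ∉ ⋃ p : ℕ, ⋃ q : ℕ, ⋃ (_ : p < q), ⋃ k : ℕ, Literature.Computability.Complexity.DTISP (fun n => n ^ k) (fun n => 2 ^ (p * Nat.log 2 n / q))) → Literature.Computability.Complexity.SAT ∉ Literature.Computability.Complexity.Classes.P

-- parent: ShadowResidual · glue (gen 1)
/--     item stmt-PneNP-26450 · support · rank 403 · open
    parent: ShadowResidual · GLUE: children ⟹ parent · by planner
SatNotInPTSL → LiftFromPTSL → ShadowResidual -/
@[route_item "route-PneNP-RootDecompSpaceChain"]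
def ShadowResidualGlue : Prop :=
  SatNotInPTSL → LiftFromPTSL → ShadowResidual

/-- item stmt-PneNP-23489 · aside · rank 9 · open · by planner
sources: AroraBarak2009, doi:10.1109/ccc.2005.6
[support] RECORD NODE (kind aside at filing; never staffed): the top of the dense dial, SAT ∉
LOGSPACE (NP ≠ L in SAT form; census row B1 shadow; lens-4 piece A SatNotInL and lens-3
SatNotLogspace verbatim); intermediate node SATNotInL ⟺ SatQuadLogspace ∧ DialLift (kernel
satNotInL_iff_quad_and_lift), S ⟹ it (hyp-free tree theorem SoloBlind.SAT_not_mem_LOGSPACE_of_pneNP,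
Theorems/SoloBlindFloor.lean:42); its exponent ladder SatNotInDTISPLog k := SAT ∉ DTISP(n^k, log n)
is anti-monotone in k and exhausts it (lens-4 LadderExhaustsL, provable now from time_lt_card). -/
@[route_item "route-PneNP-RootDecompSpaceChain"]
def SATNotInL : Prop :=
  Literature.Computability.Complexity.SAT ∉ Literature.Computability.Complexity.LOGSPACE

/-- item stmt-PneNP-23490 · aside · rank 9 · open · by planner
sources: doi:10.1109/ccc.2005.6, Cobham1966, KushilevitzNisan1997
[support] RECORD RUNG (kind aside at filing; BC5 plan-only witness for SatQuadLogspace, CALIBRATION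
only per the critic — it decides nothing about S): level 1 of the dense dial, SAT ∉ DTISP(n, log n)
— a THEOREM IN PRINT in the tree's sequential one-two-way-input-head model (Cobham 1966 crossing
sequences + Santhanam 2001, T·S = Ω(n²/polylog) for SAT; region c + d < 2), kernel road = adapt the
formalised Hennie cut-and-paste (OneTapePALLowerBound.palLowerBound_holds) to SpaceMachine with
crossing records (state, work stacks), an in-model PAL→SAT embedding, DTISP closure; implied by
SatQuadLogspace (DTISP monotonicity, writer file bc/N2_SatQuadLogspace_rung.lean) while S's own rung
1 (SAT ∉ DTIME(n), multi-stack) is open. -/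
@[route_item "route-PneNP-RootDecompSpaceChain"]
def ShadowTSOne : Prop :=
  Literature.Computability.Complexity.SAT ∉ Literature.Computability.Complexity.DTISP (fun n => n ^ 1) (Nat.log 2)

/-- item stmt-PneNP-24817 · aside · rank 9 · open · by planner
why it might fail: does not fail under S (S ⟹ G mod Zuckerman's theorem); unconditionally open: an explicit superlinear multitape lower bound for a dense NP-hard gap problem, between CLIQUE ∉ DTIME(N) and SAT ∉ DTIME(n^{c_Z(1/4)}); every known uniform method is priced (locality fan-in N^{1/2+γ}).
sources: doi:10.1145/1132516.1132612, doi:10.1016/S0022-0000(03)00110-7, arXiv:1911.08297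
[support] RECORD RUNG G of the CHILD NODE GapCliqueDial (kind aside at filing; never staffed; rev 1,
lens-1 g2 GapCliqueDial.lean sha256 749dcfff…, critic CLEARED 2026-08-30T01:56:42Z; refines
route-PneNP-RootDecompSpaceChain:stmt-PneNP-23729 — GapQuarterFine ∧ JointResidual ⟹ ShadowResidual,
kernel refines_shadowResidual / writer bc/N2_GapClique_items.lean::shadowResidual_of_gap_joint): no
LINEAR-TIME multi-stack language separates graphs with ω(G) ≥ n^{3/4} from graphs with ω(G) ≤
n^{1/4} (adjacency-matrix encoding encodingGraph, N ≈ n² bits, n ≥ 2) — GapClique(1/4) ∉ promiseLift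
(DTIME id), the lens-local GapClique/GapFine inlined (Iff.rfl gapQuarterFineItem_iff) · tag
WEAKER(formal modulo the ONE print binder CliqueGapNPHard = Zuckerman 2007 Thm 1.1 in gap form;
kernel gapQuarterFine_of_pneNP with the promise-closure fact DISCHARGED by the tree theorem
NP_subset_P_of_isNPHard_of_mem_PromiseP_holds and DTIME_id_subset_P — no model debt) · NECESSARY ·
not COSTUME (no census row; sandwiched SAT ∉ DTIME(n^{c_Z(1/4)}) ⟹ G ⟹ CLIQUE ∉ DTIME(N), both open)
· not LAW-A · shape i.o. like S · leaf IDEA-NEEDED · BARRIER-PRICED (relativization/algebrization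
price it as they price S — false -/
@[route_item "route-PneNP-RootDecompSpaceChain"]
def GapQuarterFine : Prop :=
  Literature.Computability.Complexity.PromiseProblem.ofEncoding Literature.Computability.Complexity.encodingGraph {p : (Σ n : ℕ, SimpleGraph (Fin n)) | 2 ≤ p.1 ∧ (p.1 : ℝ) ^ (1 - (1 / 4 : ℝ)) ≤ (p.2.cliqueNum : ℝ)} {p : (Σ n : ℕ, SimpleGraph (Fin n)) | 2 ≤ p.1 ∧ (p.2.cliqueNum : ℝ) ≤ (p.1 : ℝ) ^ (1 / 4 : ℝ)} ∉ Literature.Computability.Complexity.promiseLift (Literature.Computability.Complexity.DTIME fun n => n)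

/-- item stmt-PneNP-24818 · aside · rank 9 · open · by planner
why it might fail: false exactly in the world SAT ∉ L ∧ GapQuarterFine ∧ P = NP, which no known result excludes; every typed road into it inherits ShadowResidual's prices (magnification overshoot to ≥ S, bounded relativization in full).
sources: MckayMurrayWilliams2019, doi:10.1145/1132516.1132612, LadnerLynch1976, AroraBarak2009
[support] RECORD RESIDUAL VARIANT J of the child node GapCliqueDial (kind aside at filing; never
staffed; rev 1): SAT ∉ LOGSPACE → GapQuarterFine → P ≠ NP (GapQuarterFine inlined; Iff.rfl
jointResidualItem_iff) · DECLARED-RESIDUAL of the child · WEAKER(formal; S ⟹ J trivially) ·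
NECESSARY · formally strictly weaker than ShadowResidual (jointResidual_of_shadowResidual) with
GapQuarterFine ∧ JointResidual ⟹ ShadowResidual (refines_shadowResidual), but ⟺ ShadowResidual GIVEN
GapQuarterFine (critic flag F2 ZERO-SUM, writer jointResidualItem_iff_shadowResidual_of_gap: the
residual is unrelieved — no road into J uses hG — so NO SCORE vs N2; the child node ⟺ N2 ∧ G, a new
necessary conjunct and typed axis) · leaf IDEA-NEEDED · carries the summit in the child; four-binder
child closes′ hA hLift hG hJ := hJ (hLift hA) hG (lens closes, writer pneNP_of_node) is NOT this
route's glue (critic: asides until the --refines schema is live). -/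
@[route_item "route-PneNP-RootDecompSpaceChain"]
def JointResidual : Prop :=
  Literature.Computability.Complexity.SAT ∉ Literature.Computability.Complexity.LOGSPACE → Literature.Computability.Complexity.PromiseProblem.ofEncoding Literature.Computability.Complexity.encodingGraph {p : (Σ n : ℕ, SimpleGraph (Fin n)) | 2 ≤ p.1 ∧ (p.1 : ℝ) ^ (1 - (1 / 4 : ℝ)) ≤ (p.2.cliqueNum : ℝ)} {p : (Σ n : ℕ, SimpleGraph (Fin n)) | 2 ≤ p.1 ∧ (p.2.cliqueNum : ℝ) ≤ (p.1 : ℝ) ^ (1 / 4 : ℝ)} ∉ Literature.Computability.Complexity.promiseLift (Literature.Computability.Complexity.DTIME fun n => n) → PneNP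

/-- item stmt-PneNP-24819 · aside · rank 9 · open · by planner
sources: doi:10.1145/1132516.1132612, doi:10.1016/S0022-0000(03)00110-7, arXiv:1911.08297, doi:10.1007/11786986_21
[support] EQUIV RECORD of the child node GapCliqueDial (kind aside at filing; never staffed; rev 1):
the whole dial — for every ε > 0, GapClique ε ∉ promiseLift (DTIME id) (YES ω ≥ n^{1-ε}, NO ω ≤
n^{ε}, n ≥ 2, adjacency-matrix encoding; Iff.rfl gapDialItem_iff) · S ⟺ GapDial MODULO TWO NAMED
BINDERS (record, print + pencil; NOT items, NOT in closes): CliqueGapNPHard := ∀ ε > 0, IsNPHard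
(GapClique ε) [Zuckerman 2007 Thm 1.1 gap form — THEOREM IN PRINT; typing read by the critic:
trivially true for ε ≥ 1/2, no junk] and BlockMagnification := ¬S → ∃ ε > 0, GapClique ε ∈
promiseLift (DTIME id) [Srinivasan 2003 Thm 3.1(iii) block self-reduction + KERNEL
clique_block_pigeonhole + the node's elementary multi-stack accounting s = 2^⌈ℓ/4k⌉, T =
2^{⌈ℓ/10k⌉+1}, ⌈n/s⌉ blocks × O(s^{2k}) = o(N), critic re-did the arithmetic; model trap checked:
FinTM2 multi-stack linear time] (kernel pneNP_iff_gapDial; writer pneNP_iff_gapDialItem with the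
promise-closure fact discharged); monotone in ε (gapFine_mono); under P = NP an initial segment of
exponents is linear (exists_linear_segment_of_not_pneNP) · = the FIRST S-IMPLIED magnification
antecedent family in the cell · critic F1 INTERLEAVING: cofinal -/
@[route_item "route-PneNP-RootDecompSpaceChain"]
def GapDial : Prop :=
  ∀ ε : ℝ, 0 < ε → Literature.Computability.Complexity.PromiseProblem.ofEncoding Literature.Computability.Complexity.encodingGraph {p : (Σ n : ℕ, SimpleGraph (Fin n)) | 2 ≤ p.1 ∧ (p.1 : ℝ) ^ (1 - ε) ≤ (p.2.cliqueNum : ℝ)} {p : (Σ n : ℕ, SimpleGraph (Fin n)) | 2 ≤ p.1 ∧ (p.2.cliqueNum : ℝ) ≤ (p.1 : ℝ) ^ ε} ∉ Literature.Computability.Complexity.promiseLift (Literature.Computability.Complexity.DTIME fun n => n)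

/-- item stmt-PneNP-26458 · aside · rank 9 · open · by planner
why it might fail: Provable now (model bridge): fails only if the tree's one-head SpaceMachine time accounting and TM2 haltList time differ super-polynomially, which the existing hLP bridge already rules out for the log row.
sources: AroraBarak2009, doi:10.1109/ccc.2005.6
[support] MODEL BRIDGE (kind aside at filing; provable now, anyone idle may prove it; lens-4 gen 3
«SublinearSpaceLift», HOME/decomp-pnenp-lens-4/SublinearSpaceLift.lean sha256
593a919bde2e9d7151a8594e4ebab99824905827b4a2b6da84718c67af02b327, NODE-g3.md sha256 3e0fb24b…;
critic decomp-pnenp-crit-1 CLEARED 2026-08-30T02:57:17Z «law-D node at the END OF THE SPACE-EXPONENT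
CHART; birth admissible now; F5 sublinear branch under N2», probe
critic/L4_SublinearSpaceLift_g3_probe.lean sha256 d673552c; writer certificates
bc/N8_SublinearSpace_items.lean sha256 352a4910e2f1e922… + bc/N8b_Sublinear_asides.lean sha256
5ae8028615caa8b9… (Iff.rfl vs the lens defs, rc 0)): PTSL ⊆ P — one-head DTISP(n^k, s) deciders run
in TM2 polynomial time; the binder hTP of the lens's summit_iff_split (S → SatNotInPTSL), NOT used
by closes or by the split glue; port of the same one-head-DTISP ⟶ TM2-DTIME time bridge N2 carries
as hLP (TimeSpaceChainProofs:513; critic F3); too-small guard = the clock aside 23730 (L ⊆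
DTISP(poly, log)). -/
@[route_item "route-PneNP-RootDecompSpaceChain"]
def PTSLSubsetP : Prop :=
  (⋃ p : ℕ, ⋃ q : ℕ, ⋃ (_ : p < q), ⋃ k : ℕ, Literature.Computability.Complexity.DTISP (fun n => n ^ k) (fun n => 2 ^ (p * Nat.log 2 n / q))) ⊆ Literature.Computability.Complexity.Classes.P

/-- item stmt-PneNP-26459 · aside · rank 9 · open · by planner
why it might fail: Theorem in print twice over (RAM c(c+d) < 2 and one-head c + d < 2); the port must match Space.lean's one-head DTISP conventions (O-slack, input tape) — a model mismatch forces a restatement of the exponents, not a failure.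
sources: AroraBarak2009, FortnowLiptonVanMelkebeekViglas2005, Cobham1966, doi:10.1109/ccc.2005.6
[support] BC5 WITNESS CELL (kind aside; DECIDED IN PRINT, calibration — decides nothing about S;
lens-4 gen 3 «SublinearSpaceLift», HOME/decomp-pnenp-lens-4/SublinearSpaceLift.lean sha256
593a919bde2e9d7151a8594e4ebab99824905827b4a2b6da84718c67af02b327, NODE-g3.md sha256 3e0fb24b…;
critic decomp-pnenp-crit-1 CLEARED 2026-08-30T02:57:17Z «law-D node at the END OF THE SPACE-EXPONENT
CHART; birth admissible now; F5 sublinear branch under N2», probe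
critic/L4_SublinearSpaceLift_g3_probe.lean sha256 d673552c; writer certificates
bc/N8_SublinearSpace_items.lean sha256 352a4910e2f1e922… + bc/N8b_Sublinear_asides.lean sha256
5ae8028615caa8b9… (Iff.rfl vs the lens defs, rc 0)): Cell 11/10 · 1/10 = SAT ∉ DTISP(2^{⌊11·log
n/10⌋}, 2^{⌊log n/10⌋}) ≈ DTISP(n^{1.1}, n^{0.1}); in print by the RAM time–space tradeoff c(c+d) <
2 (Arora–Barak 2009 Thm 5.11; Fortnow–Lipton–van Melkebeek–Viglas 2005) and by the one-head
information bound c + d < 2 (Cobham 1966 + Santhanam 2001); follows from SatNotInPTSL (lens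
cell_of_satNotInPTSL, p < q); first prover target of the sublinear branch (port either proof against
Space.lean's DTISP). -/
@[route_item "route-PneNP-RootDecompSpaceChain"]
def CellAB : Prop :=
  Literature.Computability.Complexity.SAT ∉ Literature.Computability.Complexity.DTISP (fun n => 2 ^ (11 * Nat.log 2 n / 10)) (fun n => 2 ^ (1 * Nat.log 2 n / 10))

/-- item stmt-PneNP-26460 · aside · rank 9 · open · by planner
why it might fail: S-implied, so no failure short of P = NP; as a target it is open: both known families (information bound c + d < 2, alternation trading) are provably capped below it, exactly as for SatQuadLogspace on the log row.
sources: doi:10.1109/ccc.2005.6, arXiv:1001.0746, AroraBarak2009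
[support] FIRST OPEN CELL on the √n row (kind aside; OPEN · CALIBRATED; lens-4 gen 3
«SublinearSpaceLift», HOME/decomp-pnenp-lens-4/SublinearSpaceLift.lean sha256
593a919bde2e9d7151a8594e4ebab99824905827b4a2b6da84718c67af02b327, NODE-g3.md sha256 3e0fb24b…;
critic decomp-pnenp-crit-1 CLEARED 2026-08-30T02:57:17Z «law-D node at the END OF THE SPACE-EXPONENT
CHART; birth admissible now; F5 sublinear branch under N2», probe
critic/L4_SublinearSpaceLift_g3_probe.lean sha256 d673552c; writer certificates
bc/N8_SublinearSpace_items.lean sha256 352a4910e2f1e922… + bc/N8b_Sublinear_asides.lean sha256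
5ae8028615caa8b9… (Iff.rfl vs the lens defs, rc 0)): Cell 2/1 · 1/2 = SAT ∉ DTISP(2^{2⌊log n⌋},
2^{⌊log n/2⌋}) ≈ DTISP(n², √n); a/b + p/q = 5/2 ≥ 2 so outside the decided information region (tight
on the hyperbola for palindrome-type arguments, census T2) and outside alternation trading's reach;
S-implied via SatNotInPTSL; sibling records: CellSqrtDecided (7/5, 1/2) decided, CellNearWallDecided
(201/200, 99/100) decided, CellNearWallOpen (21/20, 99/100) open, HardAtSqrt = the whole √n row
(former gen-1 node; critic F2: no separate node). -/
@[route_item "route-PneNP-RootDecompSpaceChain"]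
def CellSqrtOpen : Prop :=
  Literature.Computability.Complexity.SAT ∉ Literature.Computability.Complexity.DTISP (fun n => 2 ^ (2 * Nat.log 2 n / 1)) (fun n => 2 ^ (1 * Nat.log 2 n / 2))

/-- item stmt-PneNP-23491 · assembly · rank 1 · open · by planner
sources: AroraBarak2009, CookClay2006
[assembly] SatQuadLogspace → DialLift → ShadowResidual → P ≠ NP (Target = ROOT statement `PneNP` ⟸ A
∧ R₁ ∧ R₂; two modus ponens steps — the frame is ground-trivial by design, the content is in the
typing of the pieces). -/
@[route_item "route-PneNP-RootDecompSpaceChain"]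
def Assembly : Prop :=
  SatQuadLogspace → DialLift → ShadowResidual → PneNP

/-! D-0027 §2.1 — DECIDING THEOREM (planner-authored via `route open/edit --closes-file`; by planner-decomp-pnenp-writer-1-g0-0 2026-08-30T01:19:56Z):
its hypotheses are this route's items and its conclusion the sub-problem Statement (glue_lint), and it elaborates with this file. -/

@[closes "route-PneNP-RootDecompSpaceChain"] theorem closes (hA : SatQuadLogspace) (hLift : DialLift) (hRes : ShadowResidual) : PneNP :=
  hRes (hLift hA)

end Summit.PneNP.PneNP.Theses.RootDecompSpaceChain
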